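import Summits.QuantumFields.BalabanUV.Beta.GAN24.DerivativeRateTransferJensenMassFreeExpTaylor
import Summits.QuantumFields.BalabanUV.Beta.GAN24.DerivativeRateTransferJensenMassFreePolarFactor

/-!
# `BalabanUV.Beta.GAN24.DerivativeRateTransferJensenMassFreeConvention` — binder row G-an2-4 ∕ (CONV-C), route R6 «VALUES, NOT DERIVATIVES», PART 68:
# ONE CONVENTION SUFFICES, TYPED — the polar coarse link (Bałaban–Jaffe (1.26)) and the exp-mean-log coarse link (their (1.28); and the Riemannian
# centre of mass (1.27) at its own base point) of transports `τ_x = exp(A_x)·τ₀` with skew `A_x`, `‖A_x‖ ≤ s ≤ 1`, agree to THIRD ORDER: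
#   `‖R′ − exp(Σ_x q_xA_x)·τ₀‖ ≤ (5∕2)·s³ + 49·s⁴ ≤ 52·s³`   (Frobenius),
# hence PART 56's transfer letter `|(R″ − R′)w|² ≤ τ²|w|²` holds with `τ = (5∕2)s³ + 49s⁴` and the transferred additive slack is `δ = (1+t⁻¹)·τ²·w_c·d′`,
# SIXTH order in the Lie-algebra spread (unit b2b-balaban-gan24-p3, gen 45; v1)

NOT IN PRINT; OUR PROOF (for the ROUTE; [folklore] — PART 66's polar-near-identity lemma + PART 67's expansion + PART 58's existence of the polar factor BY
NAME).  HONEST FRAMING (cell contract, verbatim): «discharging `BetaPertH` makes Bałaban's UV stability UNCONDITIONAL — a real constructive-QFT result; it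
is NOT the continuum limit and NOT the Clay problem.»  HONEST DEPENDENCY (verbatim): «continuum YM on T⁴ ⇐ BetaPertH ∧ nine spine estimates (0/9 proved);
BetaPertH ⇐ (D1) ∧ (D4) ∧ CAP+tail; G-an2-4 gates asym, D1 and NE2/3/4.»

WHY THIS FILE.  The pricing desk's display for the polar pair's (STAB)^{cov} (PRICING-GAN24 v3.56 C-R6°) keeps «other conventions NOT MOOT — MASSIVE-SMALL by
transfer [tree, PART 56], τ PAPER»: PART 56 `covJensen_transfer_of_polar` transfers the polar pair's `δ = 0` END to any second coarse connection `R″` with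
`|(R″_{e′} − R′_{e′})w|² ≤ τ²|w|²`, at the price `δ = (1+s⁻¹)τ²w_c d′`, and the desk's consequence ledger (v3.51 (C)) needs `τ` of THIRD order in the
spread for `δ ≍ p̂⁵ ≪ l^{−2d}` in `d = 4`.  Bałaban–Jaffe [Erice 1985 p. 221] print three block averages of the contour variables `U(Γ_x)`, `x ∈ B(y)`:
(1.26) `Proj(L^{−d}Σ_xU(Γ_x))` — the POLAR factor of the mean (PARTs 51–65's convention); (1.27) Federbush's minimiser `V` of `Σ_x dist²(U(Γ_x), V)`
(first-order condition: `Σ_x log(U(Γ_x)V⁻¹) = 0`); (1.28) `exp[L^{−d}Σ_x ln(U(Γ_x)U(yy′)⁻¹)]·U(yy′)` — the exponential of the mean logarithm relative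
to the central contour; «these proofs also extend to the other two definitions».  Writing the transports relative to a base `τ₀` as `τ_x = exp(A_x)·τ₀`
(`A_x` skew = the logarithms, DATA here; `‖A_x‖ ≤ s`), (1.28) is `R_B = exp(Ā)·τ₀`, `Ā = Σ_x q_xA_x`, and (1.27) is the base `τ₀ = V` at which `Ā = 0`.
THIS FILE: (§1) **`frob_norm_polar_sub_expMean_le`** — any orthogonal `R′` with `M·R′ᵀ` symmetric positive semidefinite, `M = Σ_x q_x•exp(A_x)`, satisfies
`‖R′ − exp(Ā)‖ ≤ (5∕2)s³ + 49s⁴` (PART 66 `frob_norm_polar_sub_le` with PART 67's `‖E‖ ≤ s² + (5∕2)s³ ≤ (7∕2)s²`, `‖E − Eᵀ‖ ≤ 5s³`); (§2) the base-point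
form **`frob_norm_polar_sub_expMean_base_le`** for `M = Σ_x q_x•(exp(A_x)·τ₀)`: `‖R′ − exp(Ā)·τ₀‖ ≤ (5∕2)s³ + 49s⁴`, and the centre-of-mass form
**`frob_norm_polar_sub_base_le`** (`Ā = 0` ⟹ `‖R′ − τ₀‖ ≤ (5∕2)s³ + 49s⁴`); (§3) PART 56's letter **`mulVec_expMean_sub_polar_sq_le`**:
`|(exp(Ā)τ₀ − R′)w|² ≤ ((5∕2)s³ + 49s⁴)²|w|²`, the bond-indexed form **`transferLetter_expMean`** (`∀ e′ w`, VERBATIM the `hτ` of `covJensen_transfer`), and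
the one-constant form `τ = 52s³`; (§4) existence: for `s ≤ 1∕4` the mean is injective (`mulVec_injective_expMean`), so PART 58 `exists_orthogonal_polar`
yields **`exists_polar_near_expMean`** — ∃ orthogonal polar `R′` within `(5∕2)s³ + 49s⁴` of `exp(Ā)·τ₀`.

WHAT THIS FILE PROVES (0 sorry, 0 `def`, nothing cited): §1 `sq_add_le`, **`frob_norm_polar_sub_expMean_le`**; §2 `wsum_mul_base`, **`frob_norm_polar_sub_expMean_base_le`**,
**`frob_norm_polar_sub_base_le`**; §3 **`mulVec_expMean_sub_polar_sq_le`**, **`transferLetter_expMean`**, `transferLetter_expMean'`; §4 `mulVec_injective_wexp`,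
**`mulVec_injective_expMean`**, **`exists_polar_near_expMean`**.
WHAT IT DOES NOT DO: produce the logarithms `A_x` of group-valued transports or bound `s` by the plaquette letter (a matrix logarithm is not in Mathlib —
`s ≍ D ≍ p̂` is the small-field dictionary, PAPER), prove existence ∕ uniqueness of the Riemannian centre of mass (only its first-order condition is used, as a
hypothesis `Ā = 0`), put `R′` in the structure group (PART 58 ∕ 65 scope), instantiate anything of Bałaban's, or claim (CONS) ∕ exact (STAB).  SUPPLIER work
on route R6 (rank 2, REDUCTION, no seat); no consumer of record; NEVER «G-an2-4 closed»; NOT (CONV-C), NOT D1, NOT `BetaPertH`, NOT continuum, NOT Clay.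
Records: `HOME/b2b-balaban-gan24-p3/WOODBURY-FIBRE.md` v14.5. -/

noncomputable section

open scoped Matrix Matrix.Norms.Frobenius
open NormedSpace Finset Matrix

namespace Summit.QuantumFields.BalabanUV.Beta.GAN24.DerivativeRateTransferJensenMassFreeConvention

open Summit.QuantumFields.BalabanUV.Beta.GAN24.DerivativeRateTransferJensenMassFreePolarNear
open Summit.QuantumFields.BalabanUV.Beta.GAN24.DerivativeRateTransferJensenMassFreeExpTaylor
open Summit.QuantumFields.BalabanUV.Beta.GAN24.DerivativeRateTransferJensenMassFreePolarFactor (exists_orthogonal_polar)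

variable {o ν : Type*} [Fintype o] [DecidableEq o] [Fintype ν]

/-! ## §1 The polar link against the exp-mean-log link (base `1`) -/

omit [Fintype o] [DecidableEq o] [Fintype ν] in
/-- arithmetic: `0 ≤ e ≤ s² + (5∕2)s³`, `k ≤ 5s³`, `0 ≤ s ≤ 1` ⟹ `½k + 4e² ≤ (5∕2)s³ + 49s⁴`. -/
theorem sq_add_le {e k s : ℝ} (he0 : 0 ≤ e) (he : e ≤ s ^ 2 + 5 / 2 * s ^ 3) (hk : k ≤ 5 * s ^ 3) (hs0 : 0 ≤ s) (hs1 : s ≤ 1) :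
    1 / 2 * k + 4 * e ^ 2 ≤ 5 / 2 * s ^ 3 + 49 * s ^ 4 := by
  have h3 : s ^ 3 ≤ s ^ 2 := pow_le_pow_of_le_one hs0 hs1 (by norm_num)
  have he' : e ≤ 7 / 2 * s ^ 2 := by linarith
  have he2 : e ^ 2 ≤ (7 / 2 * s ^ 2) ^ 2 := pow_le_pow_left₀ he0 he' 2
  nlinarith

/-- **`frob_norm_polar_sub_expMean_le` — THE POLAR LINK AND THE EXP-MEAN-LOG LINK AGREE TO THIRD ORDER** [our proof]: weights `q ≥ 0`, `Σq = 1`, skew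
`A_x` with `‖A_x‖ ≤ s ≤ 1`, `M = Σ_x q_x•exp(A_x)`; every orthogonal `R′` with `M·R′ᵀ` symmetric positive semidefinite (a polar link of `M`, PART 58)
satisfies `‖R′ − exp(Σ_x q_x•A_x)‖ ≤ (5∕2)s³ + 49s⁴`. -/
theorem frob_norm_polar_sub_expMean_le {q : ν → ℝ} (hq : ∀ x, 0 ≤ q x) (hq1 : ∑ x, q x = 1) {A : ν → Matrix o o ℝ}
    (hA : ∀ x, (A x)ᵀ = -A x) {s : ℝ} (hs : ∀ x, ‖A x‖ ≤ s) (hs1 : s ≤ 1) {R' : Matrix o o ℝ} (hR' : R'ᵀ * R' = 1)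
    (hsym : ((∑ x, q x • exp (A x)) * R'ᵀ)ᵀ = (∑ x, q x • exp (A x)) * R'ᵀ)
    (hpsd : ∀ w : o → ℝ, 0 ≤ w ⬝ᵥ (((∑ x, q x • exp (A x)) * R'ᵀ) *ᵥ w)) :
    ‖R' - exp (∑ x, q x • A x)‖ ≤ 5 / 2 * s ^ 3 + 49 * s ^ 4 := by
  have hs0 : 0 ≤ s := by
    obtain ⟨x, -, hx⟩ : ∃ x ∈ (Finset.univ : Finset ν), q x ≠ 0 :=
      Finset.exists_ne_zero_of_sum_ne_zero (by rw [hq1]; exact one_ne_zero)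
    exact (norm_nonneg _).trans (hs x)
  have hRB : (exp (∑ x, q x • A x))ᵀ * exp (∑ x, q x • A x) = 1 := orthogonal_exp_of_skew (wsum_skew hA)
  have h := frob_norm_polar_sub_le hR' hsym hpsd hRB (E := (∑ x, q x • exp (A x)) * (exp (∑ x, q x • A x))ᵀ - 1) rfl
  exact h.trans (sq_add_le (norm_nonneg _) (norm_meanDefect_le hq hq1 hA hs hs1) (norm_meanDefect_skew_le hq hq1 hA hs hs1) hs0 hs1)

/-! ## §2 Base point `τ₀`: the (1.28) link `exp(Ā)·τ₀` and the centre-of-mass base `Ā = 0` -/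

omit [DecidableEq o] in
/-- `Σ_x q_x•(B_x·τ₀) = (Σ_x q_x•B_x)·τ₀`. [folklore] -/
theorem wsum_mul_base (q : ν → ℝ) (B : ν → Matrix o o ℝ) (τ₀ : Matrix o o ℝ) :
    ∑ x, q x • (B x * τ₀) = (∑ x, q x • B x) * τ₀ := by
  rw [Matrix.sum_mul]
  exact Finset.sum_congr rfl fun x _ => (Matrix.smul_mul (q x) (B x) τ₀).symm

/-- **`frob_norm_polar_sub_expMean_base_le` — (1.26) AGAINST (1.28) AT A BASE CONTOUR** [our proof]: transports `τ_x = exp(A_x)·τ₀` (`τ₀` orthogonal,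
`A_x` skew, `‖A_x‖ ≤ s ≤ 1`), `M = Σ_x q_x•τ_x`; every orthogonal `R′` with `M·R′ᵀ` symmetric positive semidefinite satisfies
`‖R′ − exp(Σ_x q_x•A_x)·τ₀‖ ≤ (5∕2)s³ + 49s⁴`. -/
theorem frob_norm_polar_sub_expMean_base_le {q : ν → ℝ} (hq : ∀ x, 0 ≤ q x) (hq1 : ∑ x, q x = 1) {A : ν → Matrix o o ℝ}
    (hA : ∀ x, (A x)ᵀ = -A x) {s : ℝ} (hs : ∀ x, ‖A x‖ ≤ s) (hs1 : s ≤ 1) {τ₀ : Matrix o o ℝ} (hτ₀ : τ₀ᵀ * τ₀ = 1)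
    {R' : Matrix o o ℝ} (hR' : R'ᵀ * R' = 1)
    (hsym : ((∑ x, q x • (exp (A x) * τ₀)) * R'ᵀ)ᵀ = (∑ x, q x • (exp (A x) * τ₀)) * R'ᵀ)
    (hpsd : ∀ w : o → ℝ, 0 ≤ w ⬝ᵥ (((∑ x, q x • (exp (A x) * τ₀)) * R'ᵀ) *ᵥ w)) :
    ‖R' - exp (∑ x, q x • A x) * τ₀‖ ≤ 5 / 2 * s ^ 3 + 49 * s ^ 4 := by
  have hτ₀' : τ₀ * τ₀ᵀ = 1 := mul_eq_one_comm.mp hτ₀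
  -- `R′τ₀ᵀ` is a polar link of `M₀ = Σ_x q_x•exp(A_x)`
  have e0 : (∑ x, q x • (exp (A x) * τ₀)) * R'ᵀ = (∑ x, q x • exp (A x)) * (R' * τ₀ᵀ)ᵀ := by
    rw [wsum_mul_base, transpose_mul, transpose_transpose, Matrix.mul_assoc]
  have hU : (R' * τ₀ᵀ)ᵀ * (R' * τ₀ᵀ) = 1 := by
    rw [transpose_mul, transpose_transpose, Matrix.mul_assoc, ← Matrix.mul_assoc R'ᵀ, hR', Matrix.one_mul, hτ₀']
  have h := frob_norm_polar_sub_expMean_le hq hq1 hA hs hs1 hU (by rw [← e0]; exact hsym) (by rw [← e0]; exact hpsd)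
  have e1 : R' - exp (∑ x, q x • A x) * τ₀ = (R' * τ₀ᵀ - exp (∑ x, q x • A x)) * τ₀ := by
    rw [Matrix.sub_mul, Matrix.mul_assoc, hτ₀, Matrix.mul_one]
  rwa [e1, frob_norm_mul_orthogonal _ hτ₀']

/-- **`frob_norm_polar_sub_base_le` — (1.26) AGAINST (1.27)'s BASE** [our proof]: if the base `τ₀` satisfies the first-order condition of the Riemannian
centre of mass, `Σ_x q_x•A_x = 0` for `τ_x = exp(A_x)·τ₀`, then every polar link `R′` of `M = Σ_x q_x•τ_x` satisfies `‖R′ − τ₀‖ ≤ (5∕2)s³ + 49s⁴`. -/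
theorem frob_norm_polar_sub_base_le {q : ν → ℝ} (hq : ∀ x, 0 ≤ q x) (hq1 : ∑ x, q x = 1) {A : ν → Matrix o o ℝ}
    (hA : ∀ x, (A x)ᵀ = -A x) {s : ℝ} (hs : ∀ x, ‖A x‖ ≤ s) (hs1 : s ≤ 1) (hA0 : ∑ x, q x • A x = 0) {τ₀ : Matrix o o ℝ}
    (hτ₀ : τ₀ᵀ * τ₀ = 1) {R' : Matrix o o ℝ} (hR' : R'ᵀ * R' = 1)
    (hsym : ((∑ x, q x • (exp (A x) * τ₀)) * R'ᵀ)ᵀ = (∑ x, q x • (exp (A x) * τ₀)) * R'ᵀ)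
    (hpsd : ∀ w : o → ℝ, 0 ≤ w ⬝ᵥ (((∑ x, q x • (exp (A x) * τ₀)) * R'ᵀ) *ᵥ w)) :
    ‖R' - τ₀‖ ≤ 5 / 2 * s ^ 3 + 49 * s ^ 4 := by
  have h := frob_norm_polar_sub_expMean_base_le hq hq1 hA hs hs1 hτ₀ hR' hsym hpsd
  rwa [hA0, exp_zero, Matrix.one_mul] at h

/-! ## §3 PART 56's transfer letter for the exp-mean-log link -/

/-- **`mulVec_expMean_sub_polar_sq_le` — PART 56's `hτ` FOR THE (1.28) LINK** [our proof]: under the hypotheses of `frob_norm_polar_sub_expMean_base_le`,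
with `R″ = exp(Σ_x q_x•A_x)·τ₀`: `|(R″ − R′)w|² ≤ ((5∕2)s³ + 49s⁴)²·|w|²` for every `w`. -/
theorem mulVec_expMean_sub_polar_sq_le {q : ν → ℝ} (hq : ∀ x, 0 ≤ q x) (hq1 : ∑ x, q x = 1) {A : ν → Matrix o o ℝ}
    (hA : ∀ x, (A x)ᵀ = -A x) {s : ℝ} (hs : ∀ x, ‖A x‖ ≤ s) (hs1 : s ≤ 1) {τ₀ : Matrix o o ℝ} (hτ₀ : τ₀ᵀ * τ₀ = 1)
    {R' : Matrix o o ℝ} (hR' : R'ᵀ * R' = 1)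
    (hsym : ((∑ x, q x • (exp (A x) * τ₀)) * R'ᵀ)ᵀ = (∑ x, q x • (exp (A x) * τ₀)) * R'ᵀ)
    (hpsd : ∀ w : o → ℝ, 0 ≤ w ⬝ᵥ (((∑ x, q x • (exp (A x) * τ₀)) * R'ᵀ) *ᵥ w)) (w : o → ℝ) :
    ((exp (∑ x, q x • A x) * τ₀ - R') *ᵥ w) ⬝ᵥ ((exp (∑ x, q x • A x) * τ₀ - R') *ᵥ w) ≤
      (5 / 2 * s ^ 3 + 49 * s ^ 4) ^ 2 * (w ⬝ᵥ w) := by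
  have h := frob_norm_polar_sub_expMean_base_le hq hq1 hA hs hs1 hτ₀ hR' hsym hpsd
  rw [← norm_neg, neg_sub] at h
  refine (mulVec_dotProduct_self_le_frob _ w).trans (mul_le_mul_of_nonneg_right (pow_le_pow_left₀ (norm_nonneg _) h 2) ?_)
  simpa only [dotProduct] using Finset.sum_nonneg fun i _ => mul_self_nonneg (w i)

/-- **`transferLetter_expMean` — THE BOND-INDEXED LETTER, VERBATIM PART 56's `hτ`** [our proof]: for every coarse bond `e′` let the open transports be
`exp(A_{e′,x})·τ₀(e′)` (skew `A`, `‖A_{e′,x}‖ ≤ s ≤ 1`, `τ₀(e′)` orthogonal), `R′(e′)` a polar link of their `q(src′e′, ·)`-mean and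
`R″(e′) = exp(Σ_x q(src′e′,x)•A_{e′,x})·τ₀(e′)`; then `∀ e′ w, |(R″(e′) − R′(e′))w|² ≤ τ²|w|²` with `τ = (5∕2)s³ + 49s⁴`. -/
theorem transferLetter_expMean {μ β' : Type*} {q : μ → ν → ℝ} (hq : ∀ y x, 0 ≤ q y x) (hq1 : ∀ y, ∑ x, q y x = 1) {src' : β' → μ}
    {A : β' → ν → Matrix o o ℝ} (hA : ∀ e' x, (A e' x)ᵀ = -A e' x) {s : ℝ} (hs : ∀ e' x, ‖A e' x‖ ≤ s) (hs1 : s ≤ 1)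
    {τ₀ : β' → Matrix o o ℝ} (hτ₀ : ∀ e', (τ₀ e')ᵀ * τ₀ e' = 1) {R' R'' : β' → Matrix o o ℝ} (hR' : ∀ e', (R' e')ᵀ * R' e' = 1)
    (hsym : ∀ e', ((∑ x, q (src' e') x • (exp (A e' x) * τ₀ e')) * (R' e')ᵀ)ᵀ = (∑ x, q (src' e') x • (exp (A e' x) * τ₀ e')) * (R' e')ᵀ)
    (hpsd : ∀ e' (w : o → ℝ), 0 ≤ w ⬝ᵥ (((∑ x, q (src' e') x • (exp (A e' x) * τ₀ e')) * (R' e')ᵀ) *ᵥ w))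
    (hR'' : ∀ e', R'' e' = exp (∑ x, q (src' e') x • A e' x) * τ₀ e') (e' : β') (w : o → ℝ) :
    ((R'' e' - R' e') *ᵥ w) ⬝ᵥ ((R'' e' - R' e') *ᵥ w) ≤ (5 / 2 * s ^ 3 + 49 * s ^ 4) ^ 2 * (w ⬝ᵥ w) := by
  rw [hR'' e']
  exact mulVec_expMean_sub_polar_sq_le (hq (src' e')) (hq1 (src' e')) (hA e') (hs e') hs1 (hτ₀ e') (hR' e') (hsym e') (hpsd e') w

/-- `transferLetter_expMean'` — the one-constant form `τ = 52s³` (`(5∕2)s³ + 49s⁴ ≤ 52s³` for `s ≤ 1`). [our proof] -/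
theorem transferLetter_expMean' {μ β' : Type*} {q : μ → ν → ℝ} (hq : ∀ y x, 0 ≤ q y x) (hq1 : ∀ y, ∑ x, q y x = 1) {src' : β' → μ}
    {A : β' → ν → Matrix o o ℝ} (hA : ∀ e' x, (A e' x)ᵀ = -A e' x) {s : ℝ} (hs : ∀ e' x, ‖A e' x‖ ≤ s) (hs1 : s ≤ 1)
    {τ₀ : β' → Matrix o o ℝ} (hτ₀ : ∀ e', (τ₀ e')ᵀ * τ₀ e' = 1) {R' R'' : β' → Matrix o o ℝ} (hR' : ∀ e', (R' e')ᵀ * R' e' = 1)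
    (hsym : ∀ e', ((∑ x, q (src' e') x • (exp (A e' x) * τ₀ e')) * (R' e')ᵀ)ᵀ = (∑ x, q (src' e') x • (exp (A e' x) * τ₀ e')) * (R' e')ᵀ)
    (hpsd : ∀ e' (w : o → ℝ), 0 ≤ w ⬝ᵥ (((∑ x, q (src' e') x • (exp (A e' x) * τ₀ e')) * (R' e')ᵀ) *ᵥ w))
    (hR'' : ∀ e', R'' e' = exp (∑ x, q (src' e') x • A e' x) * τ₀ e') [Nonempty β'] (e' : β') (w : o → ℝ) :
    ((R'' e' - R' e') *ᵥ w) ⬝ᵥ ((R'' e' - R' e') *ᵥ w) ≤ (52 * s ^ 3) ^ 2 * (w ⬝ᵥ w) := by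
  have hs0 : 0 ≤ s := by
    obtain ⟨x, -, hx⟩ : ∃ x ∈ (Finset.univ : Finset ν), q (src' e') x ≠ 0 :=
      Finset.exists_ne_zero_of_sum_ne_zero (by rw [hq1]; exact one_ne_zero)
    exact (norm_nonneg _).trans (hs e' x)
  refine (transferLetter_expMean hq hq1 hA hs hs1 hτ₀ hR' hsym hpsd hR'' e' w).trans (mul_le_mul_of_nonneg_right ?_ ?_)
  · have h4 : s ^ 4 ≤ s ^ 3 := pow_le_pow_of_le_one hs0 hs1 (by norm_num)
    have h3 : 0 ≤ s ^ 3 := by positivity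
    exact pow_le_pow_left₀ (by positivity) (by linarith) 2
  · simpa only [dotProduct] using Finset.sum_nonneg fun i _ => mul_self_nonneg (w i)

/-! ## §4 Existence: the mean of nearby transports is injective, so a polar link within `(5∕2)s³ + 49s⁴` of the exp-mean-log link exists -/

/-- `Σ_x q_x•exp(A_x)` is injective when `‖A_x‖ ≤ s ≤ 1∕4` (`‖M − 1‖ ≤ 2s ≤ ½ < 1`). [our proof] -/
theorem mulVec_injective_wexp {q : ν → ℝ} (hq : ∀ x, 0 ≤ q x) (hq1 : ∑ x, q x = 1) {A : ν → Matrix o o ℝ} {s : ℝ}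
    (hs : ∀ x, ‖A x‖ ≤ s) (hs4 : s ≤ 1 / 4) : Function.Injective (∑ x, q x • exp (A x)).mulVec := by
  set M : Matrix o o ℝ := ∑ x, q x • exp (A x) with hMdef
  have hM1 : ‖M - 1‖ ≤ 1 / 2 := by
    have e : M - 1 = ∑ x, q x • (exp (A x) - 1) := by
      have h1 : ∑ x, q x • (1 : Matrix o o ℝ) = 1 := by rw [← Finset.sum_smul, hq1, one_smul]
      simp only [smul_sub, Finset.sum_sub_distrib, h1, hMdef]
    rw [e]
    refine (norm_wsum_le hq _).trans ((wsum_le_of_le hq hq1 fun x => ?_).trans (by linarith : 2 * s ≤ 1 / 2))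
    exact (norm_exp_sub_one_le (A x) ((hs x).trans (by linarith))).trans (by linarith [hs x])
  intro v v' hvv
  -- `w := v − v′` satisfies `(M − 1)w = −w`, so `|w|² ≤ ¼|w|²`
  have hw : (M - 1) *ᵥ (v - v') = -(v - v') := by
    rw [Matrix.sub_mulVec, Matrix.one_mulVec, Matrix.mulVec_sub, hvv, sub_self, zero_sub]
  have h := mulVec_dotProduct_self_le_frob (M - 1) (v - v')
  rw [hw, neg_dotProduct, dotProduct_neg, neg_neg] at h
  have h2 : ‖M - 1‖ ^ 2 ≤ 1 / 4 := by nlinarith [norm_nonneg (M - 1)]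
  have hw0 : 0 ≤ (v - v') ⬝ᵥ (v - v') := by
    simpa only [dotProduct] using Finset.sum_nonneg fun i _ => mul_self_nonneg ((v - v') i)
  have h3 : (v - v') ⬝ᵥ (v - v') = 0 := by nlinarith
  refine sub_eq_zero.mp (funext fun i => ?_)
  have h4 : ∑ j, (v - v') j * (v - v') j = 0 := h3
  have h5 := (Finset.sum_eq_zero_iff_of_nonneg fun j _ => mul_self_nonneg ((v - v') j)).mp h4 i (Finset.mem_univ i)
  exact mul_self_eq_zero.mp h5

/-- **`mulVec_injective_expMean`**: `Σ_x q_x•(exp(A_x)·τ₀)` is injective when `‖A_x‖ ≤ s ≤ 1∕4` and `τ₀` is orthogonal. [our proof] -/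
theorem mulVec_injective_expMean {q : ν → ℝ} (hq : ∀ x, 0 ≤ q x) (hq1 : ∑ x, q x = 1) {A : ν → Matrix o o ℝ} {s : ℝ}
    (hs : ∀ x, ‖A x‖ ≤ s) (hs4 : s ≤ 1 / 4) {τ₀ : Matrix o o ℝ} (hτ₀ : τ₀ᵀ * τ₀ = 1) :
    Function.Injective (∑ x, q x • (exp (A x) * τ₀)).mulVec := by
  rw [wsum_mul_base]
  intro v w hvw
  have h : (∑ x, q x • exp (A x)) *ᵥ (τ₀ *ᵥ v) = (∑ x, q x • exp (A x)) *ᵥ (τ₀ *ᵥ w) := by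
    simpa only [Matrix.mulVec_mulVec] using hvw
  have h2 := mulVec_injective_wexp hq hq1 hs hs4 h
  have h3 : τ₀ᵀ *ᵥ (τ₀ *ᵥ v) = τ₀ᵀ *ᵥ (τ₀ *ᵥ w) := by rw [h2]
  rwa [Matrix.mulVec_mulVec, Matrix.mulVec_mulVec, hτ₀, Matrix.one_mulVec, Matrix.one_mulVec] at h3

/-- **`exists_polar_near_expMean` — A POLAR LINK WITHIN `(5∕2)s³ + 49s⁴` OF THE EXP-MEAN-LOG LINK EXISTS** [our proof; PART 58 `exists_orthogonal_polar`]: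
weights `q ≥ 0`, `Σq = 1`, skew `A_x` with `‖A_x‖ ≤ s ≤ 1∕4`, `τ₀` orthogonal, `M = Σ_x q_x•(exp(A_x)·τ₀)` ⟹ ∃ orthogonal `R′` with `M·R′ᵀ` symmetric
positive semidefinite and `‖R′ − exp(Σ_x q_x•A_x)·τ₀‖ ≤ (5∕2)s³ + 49s⁴`. -/
theorem exists_polar_near_expMean {q : ν → ℝ} (hq : ∀ x, 0 ≤ q x) (hq1 : ∑ x, q x = 1) {A : ν → Matrix o o ℝ}
    (hA : ∀ x, (A x)ᵀ = -A x) {s : ℝ} (hs : ∀ x, ‖A x‖ ≤ s) (hs4 : s ≤ 1 / 4) {τ₀ : Matrix o o ℝ} (hτ₀ : τ₀ᵀ * τ₀ = 1) :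
    ∃ R' : Matrix o o ℝ, R'ᵀ * R' = 1 ∧
      ((∑ x, q x • (exp (A x) * τ₀)) * R'ᵀ)ᵀ = (∑ x, q x • (exp (A x) * τ₀)) * R'ᵀ ∧
      (∀ w : o → ℝ, 0 ≤ w ⬝ᵥ (((∑ x, q x • (exp (A x) * τ₀)) * R'ᵀ) *ᵥ w)) ∧
      ‖R' - exp (∑ x, q x • A x) * τ₀‖ ≤ 5 / 2 * s ^ 3 + 49 * s ^ 4 := by
  obtain ⟨R', hR', hsym, hpsd⟩ := exists_orthogonal_polar (mulVec_injective_expMean hq hq1 hs hs4 hτ₀)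
  exact ⟨R', hR', hsym, hpsd, frob_norm_polar_sub_expMean_base_le hq hq1 hA hs (hs4.trans (by norm_num)) hτ₀ hR' hsym hpsd⟩

end Summit.QuantumFields.BalabanUV.Beta.GAN24.DerivativeRateTransferJensenMassFreeConvention
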